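import Literature.AlgebraicGeometry.Resolution.DecompletionControl
import HarnessLib

/-!
# Temkin's decompletion lemma, algebraic proof — IV. The zoom: units, parameters, control

Topic: `Literature/AlgebraicGeometry/Resolution`. M. Temkin, *Inseparable local uniformization*,
J. Algebra 373 (2013) 65–119 = arXiv:0804.1554v3, Lemma 3.3.2 (tree: `Temkin2013_Lemma332_nft`).
Temkin's refinement is "`X′ = Nr(Spec(A[f/π]))`" for functions `f` cutting out a small
Weierstrass neighbourhood `W = 𝔛_η{f/π}` of the point `x̂` (p. 46). This file prepares the
finite-level ingredients of the algebraic version of that zoom, for a `DecompChart`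
(`DecompletionSetup.lean`) with its exact linear control (`DecompletionControl.lean`):

* `awaySubring S d hd` — the tree's `locAway` for subrings (`ℤ`-subalgebras) of `K`, with the
  `Subring`-typed API used by the zoom rings — PROVED glue.
* `Rx φ`, `ev φ` — the local ring of the generic fibre at the point inside `K`
  (`z` with `b z ∈ k[A]`, `φ(b) ≠ 0`) and the VALUE AT THE POINT `ev φ : K → m` (total
  function, `φ(bz)/φ(b)` on `Rx`, well defined: `ev_eq_div`), with its calculus — PROVED.
* `DecompChart.τ` — the zoom parameters `τᵢ = π^c h^L Tᵢ ∈ A₀ = k°[f]` ("multiplying by a large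
  power of `π`", p. 46), `TauControlled`/`RTauControlled` (`π^e g = Σ τᵢ aᵢ`) and the passage
  `rtauControlled_of_eq_sum` from linear control in `Rh` to `τ`-control — PROVED.
* `DecompChart.s` — the UNIT OF THE ZOOM `s = h^α s₀ ∈ k[A]` with `s(x) = 1`, and the
  `τ`-control of `s(s-1)` and `s(h-1)` (`tauControlled_s_mul_s_sub_one`,
  `tauControlled_s_mul_h_sub_one`): in the zoom rings `s` will be an approximate idempotent
  separating the centre of `m°` from the rest of the special fibre, and `h` a unit near it;
  `tauControlled_of_ev_eq_zero` — every function vanishing at the point is `τ`-controlled after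
  multiplication by `h^{a+L} s₀` — PROVED.

All statements are [folklore]; no named facts.

## Sources

* M. Temkin, arXiv:0804.1554v3, proof of Lemma 3.3.2 (pp. 45–46).
-/

noncomputable section

open Polynomial

namespace Literature.AlgebraicGeometry.Resolution

universe u

variable {k K m : Type u} [Field k] [Field K] [Algebra k K] [Field m] [Algebra k m]

/-! ### Localization of a subring of `K` away from an element

This is the tree's `locAway` (`ValuedFunctionFieldsLemmas.lean`) for subrings, i.e. for
`ℤ`-subalgebras: we DEFINE `awaySubring S d hd` as `(locAway (subalgebraOfSubring S) d hd)` viewed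
back as a subring, and only record the `Subring`-typed API the zoom rings need. -/

/-- The localization `S[1/d] ⊆ K` of a subring of a field at an element `d ∈ S` — the tree's
`locAway` applied to `S` as a `ℤ`-subalgebra: the `z` with `z dᴺ ∈ S`. [folklore] -/
def awaySubring (S : Subring K) (d : K) (hd : d ∈ S) : Subring K :=
  (locAway (subalgebraOfSubring S) d (mem_subalgebraOfSubring.mpr hd)).toSubring

/-- Membership in `S[1/d]` (in the order `dᴺ z ∈ S` used below). [folklore] -/
theorem mem_awaySubring_iff {S : Subring K} {d : K} {hd : d ∈ S} {z : K} :
    z ∈ awaySubring S d hd ↔ ∃ N : ℕ, d ^ N * z ∈ S := by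
  change z ∈ locAway (subalgebraOfSubring S) d (mem_subalgebraOfSubring.mpr hd) ↔ _
  rw [mem_locAway_iff]
  simp only [mem_subalgebraOfSubring, mul_comm z]

/-- `S ≤ S[1/d]`. [folklore] -/
theorem le_awaySubring (S : Subring K) (d : K) (hd : d ∈ S) : S ≤ awaySubring S d hd :=
  fun z hz => mem_awaySubring_iff.mpr ⟨0, by simpa using hz⟩

/-- `d⁻¹ ∈ S[1/d]` (for `d ≠ 0`). [folklore] -/
theorem inv_mem_awaySubring (S : Subring K) {d : K} (hd : d ∈ S) (hd0 : d ≠ 0) :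
    d⁻¹ ∈ awaySubring S d hd :=
  mem_awaySubring_iff.mpr ⟨1, by rw [pow_one, mul_inv_cancel₀ hd0]; exact S.one_mem⟩

/-- A factor of the denominator is inverted too. [folklore] -/
theorem inv_mem_awaySubring_of_dvd (S : Subring K) {d e e' : K} (hd : d ∈ S) (he' : e' ∈ S)
    (hde : d = e * e') (hd0 : d ≠ 0) : e⁻¹ ∈ awaySubring S d hd := by
  refine mem_awaySubring_iff.mpr ⟨1, ?_⟩
  have he0 : e ≠ 0 := fun h0 => hd0 (by rw [hde, h0, zero_mul])
  rw [pow_one, hde, mul_comm e, mul_assoc, mul_inv_cancel₀ he0, mul_one]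
  exact he'

/-- `S[1/d]` as an `S`-algebra (by inclusion). [folklore] -/
instance algebra_awaySubring (S : Subring K) (d : K) (hd : d ∈ S) :
    Algebra S (awaySubring S d hd) :=
  (Subring.inclusion (le_awaySubring S d hd)).toAlgebra

/-- `S → S[1/d] → K` is a tower. [folklore] -/
instance isScalarTower_awaySubring (S : Subring K) (d : K) (hd : d ∈ S) :
    IsScalarTower S (awaySubring S d hd) K :=
  IsScalarTower.of_algebraMap_eq fun _ => rfl

/-- `S[1/d] ⊆ K` is the localization of `S` away from `d` (for `d ≠ 0`). [folklore] -/
theorem isLocalization_awaySubring (S : Subring K) {d : K} (hd : d ∈ S) (hd0 : d ≠ 0) :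
    IsLocalization.Away (⟨d, hd⟩ : S) (awaySubring S d hd) := by
  refine (isLocalization_iff _ _).mpr ⟨?_, ?_, ?_⟩
  · rintro ⟨_, N, rfl⟩
    refine isUnit_iff_exists_inv.mpr ⟨⟨(d ^ N)⁻¹, ?_⟩, ?_⟩
    · rw [← inv_pow]
      exact Subring.pow_mem _ (inv_mem_awaySubring S hd hd0) N
    · apply Subtype.ext
      change ((⟨d, hd⟩ : S) ^ N : S) * (d ^ N)⁻¹ = (1 : K)
      simp [mul_inv_cancel₀ (pow_ne_zero N hd0)]
  · rintro ⟨z, hz⟩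
    obtain ⟨N, hN⟩ := mem_awaySubring_iff.mp hz
    refine ⟨⟨⟨d ^ N * z, hN⟩, ⟨⟨d, hd⟩ ^ N, N, rfl⟩⟩, ?_⟩
    apply Subtype.ext
    change z * ((⟨d, hd⟩ ^ N : S) : K) = d ^ N * z
    simp [mul_comm]
  · intro a b hab
    refine ⟨1, ?_⟩
    have : (a : K) = b := congrArg (fun z : awaySubring S d hd => (z : K)) hab
    rw [Subtype.ext this]

/-! ### Basic objects of the zoom: `π`, `k°[f]`, evaluation at the point, `τ` -/

namespace DecompChart

variable {V : ValuationSubring k} {O : ValuationSubring m} {A : Subring K}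
  {φ : Algebra.adjoin k (A : Set K) →ₐ[k] m} (C : DecompChart V O A φ)

/-- `π` as an element of `K`. [folklore] -/
def πK : K := algebraMap k K C.π

/-- `π ≠ 0` in `K`. [folklore] -/
theorem πK_ne_zero : C.πK ≠ 0 := C.algebraMap_π_ne_zero

/-- `π ∈ k° ⊆ K`. [folklore] -/
theorem πK_mem_baseRing : C.πK ∈ baseRing K V := ⟨C.π, C.hπV, rfl⟩

/-- The finite-level model `A₀ = k°[f] ⊆ A`. [folklore] -/
def A₀ : Subring K := Subring.closure ((baseRing K V : Set K) ∪ ↑C.f)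

/-- `k° ⊆ A₀`. [folklore] -/
theorem baseRing_le_A₀ : baseRing K V ≤ C.A₀ := fun _ hz =>
  Subring.subset_closure (Set.mem_union_left _ hz)

/-- `π ∈ A₀`. [folklore] -/
theorem πK_mem_A₀ : C.πK ∈ C.A₀ := C.baseRing_le_A₀ C.πK_mem_baseRing

/-- `f ⊆ A₀`. [folklore] -/
theorem f_subset_A₀ : (↑C.f : Set K) ⊆ C.A₀ := fun _ hz =>
  Subring.subset_closure (Set.mem_union_right _ hz)

/-- `A₀ ⊆ A`. [folklore] -/
theorem A₀_le_A : C.A₀ ≤ A := fun z hz =>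
  (C.hAint z).mpr (isIntegral_algebraMap (A := K) (x := (⟨z, hz⟩ : C.A₀)))

/-- `A` is the integral closure of `A₀` in `K`. [folklore] -/
theorem mem_A_iff (z : K) : z ∈ A ↔ IsIntegral C.A₀ z := C.hAint z

/-- `R ⊆ Rh`. [folklore] -/
theorem R_le_Rh : Algebra.adjoin k (A : Set K) ≤ C.Rh := le_locAway

/-- `A₀ ⊆ Rh`. [folklore] -/
theorem A₀_subset_Rh {z : K} (hz : z ∈ C.A₀) : z ∈ C.Rh := C.R_le_Rh (Algebra.subset_adjoin (C.A₀_le_A hz))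

/-- `k°`-constants lie in `A₀`. [folklore] -/
theorem algebraMap_mem_A₀ {c : k} (hc : c ∈ V) : algebraMap k K c ∈ C.A₀ :=
  C.baseRing_le_A₀ ⟨c, hc, rfl⟩

/-! ### The local ring at the point inside `K`, and evaluation at the point -/

end DecompChart

section Point

variable {A : Subring K} (φ : Algebra.adjoin k (A : Set K) →ₐ[k] m)

/-- **The local ring of the generic fibre at the point**, inside `K`: the `z ∈ K` with `b z ∈ R`
for some `b ∈ R = k[A]` not vanishing at the point (`φ(b) ≠ 0`). All rings of the construction
(`Rh`, the zoom models and their localizations at elements with value `1`) lie in it. [folklore] -/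
def Rx : Subalgebra k K where
  carrier := {z | ∃ (b : K) (hb : b ∈ Algebra.adjoin k (A : Set K)), φ ⟨b, hb⟩ ≠ 0 ∧
    b * z ∈ Algebra.adjoin k (A : Set K)}
  mul_mem' := by
    rintro z w ⟨b, hb, hφb, hbz⟩ ⟨b', hb', hφb', hbw⟩
    refine ⟨b * b', Subalgebra.mul_mem _ hb hb', ?_, ?_⟩
    · have : (⟨b * b', Subalgebra.mul_mem _ hb hb'⟩ : Algebra.adjoin k (A : Set K)) =
          ⟨b, hb⟩ * ⟨b', hb'⟩ := rfl
      rw [this, map_mul]; exact mul_ne_zero hφb hφb'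
    · have : b * b' * (z * w) = (b * z) * (b' * w) := by ring
      rw [this]; exact Subalgebra.mul_mem _ hbz hbw
  one_mem' := ⟨1, Subalgebra.one_mem _, by
    have : (⟨(1 : K), Subalgebra.one_mem _⟩ : Algebra.adjoin k (A : Set K)) = 1 := rfl
    rw [this, map_one]; exact one_ne_zero, by simp⟩
  add_mem' := by
    rintro z w ⟨b, hb, hφb, hbz⟩ ⟨b', hb', hφb', hbw⟩
    refine ⟨b * b', Subalgebra.mul_mem _ hb hb', ?_, ?_⟩
    · have : (⟨b * b', Subalgebra.mul_mem _ hb hb'⟩ : Algebra.adjoin k (A : Set K)) =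
          ⟨b, hb⟩ * ⟨b', hb'⟩ := rfl
      rw [this, map_mul]; exact mul_ne_zero hφb hφb'
    · have : b * b' * (z + w) = b' * (b * z) + b * (b' * w) := by ring
      rw [this]
      exact Subalgebra.add_mem _ (Subalgebra.mul_mem _ hb' hbz) (Subalgebra.mul_mem _ hb hbw)
  zero_mem' := ⟨1, Subalgebra.one_mem _, by
    have : (⟨(1 : K), Subalgebra.one_mem _⟩ : Algebra.adjoin k (A : Set K)) = 1 := rfl
    rw [this, map_one]; exact one_ne_zero, by simp⟩
  algebraMap_mem' c := ⟨1, Subalgebra.one_mem _, by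
    have : (⟨(1 : K), Subalgebra.one_mem _⟩ : Algebra.adjoin k (A : Set K)) = 1 := rfl
    rw [this, map_one]; exact one_ne_zero, by simp⟩

/-- Membership in `Rx`. [folklore] -/
theorem mem_Rx_iff (z : K) : z ∈ (Rx φ) ↔ ∃ (b : K) (hb : b ∈ Algebra.adjoin k (A : Set K)),
    φ ⟨b, hb⟩ ≠ 0 ∧ b * z ∈ Algebra.adjoin k (A : Set K) := Iff.rfl

/-- `R ≤ Rx`. [folklore] -/
theorem R_le_Rx : Algebra.adjoin k (A : Set K) ≤ (Rx φ) := fun z hz =>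
  ⟨1, Subalgebra.one_mem _, by
    have : (⟨(1 : K), Subalgebra.one_mem _⟩ : Algebra.adjoin k (A : Set K)) = 1 := rfl
    rw [this, map_one]; exact one_ne_zero, by simpa using hz⟩

/-- **Evaluation at the point**, as a total function on `K`: `φ(bz)/φ(b)` on `Rx` (independent
of the representation), junk (`0`) outside. [folklore] -/
def ev (z : K) : m := by
  classical
  exact if hz : z ∈ (Rx φ) then
    φ ⟨hz.choose * z, hz.choose_spec.choose_spec.2⟩ / φ ⟨hz.choose, hz.choose_spec.choose⟩
  else 0

/-- **`ev` is well defined**: `ev z = φ(bz)/φ(b)` for ANY `b ∈ R` with `φ(b) ≠ 0` and `bz ∈ R`.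
[folklore] -/
theorem ev_eq_div {z b : K} (hb : b ∈ Algebra.adjoin k (A : Set K)) (hφb : φ ⟨b, hb⟩ ≠ 0)
    (hbz : b * z ∈ Algebra.adjoin k (A : Set K)) : ev φ z = φ ⟨b * z, hbz⟩ / φ ⟨b, hb⟩ := by
  have hz : z ∈ (Rx φ) := ⟨b, hb, hφb, hbz⟩
  unfold ev
  rw [dif_pos hz]
  -- compare the chosen representation with the given one
  set b₁ := hz.choose with hb₁def
  have hb₁ : b₁ ∈ Algebra.adjoin k (A : Set K) := hz.choose_spec.choose
  have hφb₁ : φ ⟨b₁, hb₁⟩ ≠ 0 := hz.choose_spec.choose_spec.1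
  have hb₁z : b₁ * z ∈ Algebra.adjoin k (A : Set K) := hz.choose_spec.choose_spec.2
  rw [div_eq_div_iff hφb₁ hφb, ← map_mul, ← map_mul]
  congr 1
  apply Subtype.ext
  simp only [Subalgebra.coe_mul]
  ring

/-- `ev` is `φ` on `R = k[A]`. [folklore] -/
theorem ev_eq_φ {z : K} (hz : z ∈ Algebra.adjoin k (A : Set K)) : ev φ z = φ ⟨z, hz⟩ := by
  have h1 : (⟨(1 : K), Subalgebra.one_mem _⟩ : Algebra.adjoin k (A : Set K)) = 1 := rfl
  rw [ev_eq_div φ (Subalgebra.one_mem _) (by rw [h1, map_one]; exact one_ne_zero)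
    (by simpa using hz), h1, map_one, div_one]
  congr 1
  apply Subtype.ext
  exact one_mul z

/-- `ev` is multiplicative on `Rx`. [folklore] -/
theorem ev_mul {z w : K} (hz : z ∈ (Rx φ)) (hw : w ∈ (Rx φ)) : ev φ (z * w) = ev φ z * ev φ w := by
  obtain ⟨b, hb, hφb, hbz⟩ := hz
  obtain ⟨b', hb', hφb', hbw⟩ := hw
  have hbb' : b * b' ∈ Algebra.adjoin k (A : Set K) := Subalgebra.mul_mem _ hb hb'
  have hmul : (⟨b * b', hbb'⟩ : Algebra.adjoin k (A : Set K)) = ⟨b, hb⟩ * ⟨b', hb'⟩ := rfl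
  have hφbb' : φ ⟨b * b', hbb'⟩ ≠ 0 := by rw [hmul, map_mul]; exact mul_ne_zero hφb hφb'
  have hprod : b * b' * (z * w) ∈ Algebra.adjoin k (A : Set K) := by
    have : b * b' * (z * w) = (b * z) * (b' * w) := by ring
    rw [this]; exact Subalgebra.mul_mem _ hbz hbw
  rw [ev_eq_div φ hbb' hφbb' hprod, ev_eq_div φ hb hφb hbz, ev_eq_div φ hb' hφb' hbw,
    div_mul_div_comm, ← map_mul, ← map_mul]
  congr 2
  apply Subtype.ext; change b * b' * (z * w) = b * z * (b' * w); ring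

/-- `ev` is additive on `Rx`. [folklore] -/
theorem ev_add {z w : K} (hz : z ∈ (Rx φ)) (hw : w ∈ (Rx φ)) : ev φ (z + w) = ev φ z + ev φ w := by
  obtain ⟨b, hb, hφb, hbz⟩ := hz
  obtain ⟨b', hb', hφb', hbw⟩ := hw
  have hbb' : b * b' ∈ Algebra.adjoin k (A : Set K) := Subalgebra.mul_mem _ hb hb'
  have hmul : (⟨b * b', hbb'⟩ : Algebra.adjoin k (A : Set K)) = ⟨b, hb⟩ * ⟨b', hb'⟩ := rfl
  have hφbb' : φ ⟨b * b', hbb'⟩ ≠ 0 := by rw [hmul, map_mul]; exact mul_ne_zero hφb hφb'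
  have hsum : b * b' * (z + w) ∈ Algebra.adjoin k (A : Set K) := by
    have : b * b' * (z + w) = b' * (b * z) + b * (b' * w) := by ring
    rw [this]
    exact Subalgebra.add_mem _ (Subalgebra.mul_mem _ hb' hbz) (Subalgebra.mul_mem _ hb hbw)
  rw [ev_eq_div φ hbb' hφbb' hsum, ev_eq_div φ hb hφb hbz, ev_eq_div φ hb' hφb' hbw,
    div_add_div _ _ hφb hφb', hmul, map_mul]
  congr 1
  have e1 : (⟨b * b' * (z + w), hsum⟩ : Algebra.adjoin k (A : Set K)) =
      ⟨b * z, hbz⟩ * ⟨b', hb'⟩ + ⟨b, hb⟩ * ⟨b' * w, hbw⟩ := by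
    apply Subtype.ext; change b * b' * (z + w) = b * z * b' + b * (b' * w); ring
  rw [e1, map_add, map_mul, map_mul]

/-- `ev` is subtractive on `Rx`. [folklore] -/
theorem ev_sub {z w : K} (hz : z ∈ (Rx φ)) (hw : w ∈ (Rx φ)) : ev φ (z - w) = ev φ z - ev φ w := by
  have hneg : -w ∈ (Rx φ) := (Rx φ).neg_mem hw
  have h1 : ev φ (-w) = - ev φ w := by
    have : ev φ (-w) + ev φ w = 0 := by
      rw [← ev_add φ hneg hw, neg_add_cancel, ev_eq_φ φ (Subalgebra.zero_mem _)]
      exact map_zero φ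
    exact eq_neg_of_add_eq_zero_left this
  rw [sub_eq_add_neg, ev_add φ hz hneg, h1, sub_eq_add_neg]

/-- `ev` on powers. [folklore] -/
theorem ev_pow {z : K} (hz : z ∈ (Rx φ)) (N : ℕ) : ev φ (z ^ N) = ev φ z ^ N := by
  induction N with
  | zero => rw [pow_zero, pow_zero, ev_eq_φ φ (Subalgebra.one_mem _)]; exact map_one φ
  | succ N ih => rw [pow_succ, ev_mul φ ((Rx φ).pow_mem hz N) hz, ih, pow_succ]

/-- `ev 1 = 1`. [folklore] -/
@[simp] theorem ev_one : ev φ 1 = 1 := by rw [ev_eq_φ φ (Subalgebra.one_mem _)]; exact map_one φ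

/-- `ev 0 = 0`. [folklore] -/
@[simp] theorem ev_zero : ev φ 0 = 0 := by rw [ev_eq_φ φ (Subalgebra.zero_mem _)]; exact map_zero φ

/-- `ev` on finite sums of elements of `Rx`. [folklore] -/
theorem ev_sum {ι : Type*} (s : Finset ι) (g : ι → K) (hg : ∀ i ∈ s, g i ∈ (Rx φ)) :
    ev φ (∑ i ∈ s, g i) = ∑ i ∈ s, ev φ (g i) := by
  classical
  induction s using Finset.induction_on with
  | empty => simp
  | insert a s ha ih =>
    rw [Finset.sum_insert ha, Finset.sum_insert ha,
      ev_add φ (hg a (Finset.mem_insert_self a s))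
        ((Rx φ).sum_mem fun i hi => hg i (Finset.mem_insert_of_mem hi)),
      ih fun i hi => hg i (Finset.mem_insert_of_mem hi)]

/-- `ev` on constants. [folklore] -/
@[simp] theorem ev_algebraMap (c : k) : ev φ (algebraMap k K c) = algebraMap k m c := by
  rw [ev_eq_φ φ (Subalgebra.algebraMap_mem _ c)]
  exact φ.commutes c

/-- **Regular functions with non-zero value at the point are invertible in the local ring**:
`z ∈ Rx`, `ev z ≠ 0` ⇒ `z⁻¹ ∈ Rx`. [folklore] -/
theorem inv_mem_Rx {z : K} (hz : z ∈ (Rx φ)) (hz0 : ev φ z ≠ 0) : z⁻¹ ∈ (Rx φ) := by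
  obtain ⟨b, hb, hφb, hbz⟩ := hz
  have hφbz : φ ⟨b * z, hbz⟩ ≠ 0 := by
    rw [ev_eq_div φ hb hφb hbz] at hz0
    exact fun h0 => hz0 (by rw [h0, zero_div])
  have hzne : z ≠ 0 := by
    rintro rfl
    apply hφbz
    have : (⟨b * 0, hbz⟩ : Algebra.adjoin k (A : Set K)) = 0 := Subtype.ext (mul_zero b)
    rw [this, map_zero]
  refine ⟨b * z, hbz, hφbz, ?_⟩
  rw [mul_assoc, mul_inv_cancel₀ hzne, mul_one]; exact hb

/-- A localization of a subring of `Rx` at an element with non-zero value stays in `Rx`.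
[folklore] -/
theorem awaySubring_subset_Rx {S : Subring K} (hS : ∀ z ∈ S, z ∈ (Rx φ)) {d : K} (hd : d ∈ S)
    (hd0 : ev φ d ≠ 0) {z : K} (hz : z ∈ awaySubring S d hd) : z ∈ (Rx φ) := by
  obtain ⟨N, hN⟩ := mem_awaySubring_iff.mp hz
  have hdN : d ^ N ≠ 0 := pow_ne_zero N (fun h0 => hd0 (by rw [h0, ev_zero φ]))
  have : z = (d ^ N)⁻¹ * (d ^ N * z) := by rw [← mul_assoc, inv_mul_cancel₀ hdN, one_mul]
  rw [this]
  refine (Rx φ).mul_mem (inv_mem_Rx φ ((Rx φ).pow_mem (hS d hd) N) ?_) (hS _ hN)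
  rw [ev_pow φ (hS d hd)]; exact pow_ne_zero N hd0


end Point

namespace DecompChart

variable {V : ValuationSubring k} {O : ValuationSubring m} {A : Subring K}
  {φ : Algebra.adjoin k (A : Set K) →ₐ[k] m} (C : DecompChart V O A φ)

/-! #### The chart inside the local ring at the point -/

/-- `Rh ≤ Rx` (`φ(h) = 1 ≠ 0`). [folklore] -/
theorem Rh_le_Rx : C.Rh ≤ (Rx φ) := fun z hz => by
  obtain ⟨N, hN⟩ := (C.mem_Rh_iff z).mp hz
  refine ⟨C.h ^ N, Subalgebra.pow_mem _ C.hhR N, ?_, hN⟩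
  have : (⟨C.h ^ N, Subalgebra.pow_mem _ C.hhR N⟩ : Algebra.adjoin k (A : Set K)) =
      ⟨C.h, C.hhR⟩ ^ N := rfl
  rw [this, map_pow, C.hφh, one_pow]; exact one_ne_zero

/-- `A₀ ⊆ Rx`. [folklore] -/
theorem A₀_subset_Rx {z : K} (hz : z ∈ C.A₀) : z ∈ (Rx φ) := R_le_Rx φ (Algebra.subset_adjoin (C.A₀_le_A hz))

/-- `ev` is `φh` on `Rh`. [folklore] -/
theorem ev_of_mem {z : K} (hz : z ∈ C.Rh) : ev φ z = C.φh ⟨z, hz⟩ := by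
  obtain ⟨N, hN⟩ := (C.mem_Rh_iff z).mp hz
  have hpow : (⟨C.h ^ N, Subalgebra.pow_mem _ C.hhR N⟩ : Algebra.adjoin k (A : Set K)) =
      ⟨C.h, C.hhR⟩ ^ N := rfl
  have hφ1 : φ ⟨C.h ^ N, Subalgebra.pow_mem _ C.hhR N⟩ = 1 := by
    rw [hpow, map_pow, C.hφh, one_pow]
  rw [ev_eq_div φ (Subalgebra.pow_mem _ C.hhR N) (by rw [hφ1]; exact one_ne_zero) hN, hφ1,
    div_one, ← C.hφhφ _ (C.R_le_Rh hN)]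
  -- `φh (h^N z) = φh(h)^N φh(z) = φh z`
  have : (⟨C.h ^ N * z, C.R_le_Rh hN⟩ : C.Rh) = ⟨C.h, C.R_le_Rh C.hhR⟩ ^ N * ⟨z, hz⟩ := rfl
  rw [this, map_mul, map_pow, C.hφhφ ⟨C.h, C.hhR⟩, C.hφh, one_pow, one_mul]

/-- `ev π = π`. [folklore] -/
theorem ev_πK : ev φ C.πK = algebraMap k m C.π := ev_algebraMap φ C.π

/-- `ev h = 1`. [folklore] -/
theorem ev_h : ev φ C.h = 1 := by rw [ev_eq_φ φ C.hhR]; exact C.hφh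

/-- `ev Tᵢ = 0`. [folklore] -/
theorem ev_T (i : Fin C.n) : ev φ (C.T i) = 0 := by rw [C.ev_of_mem (C.hTRh i)]; exact C.hφT i

include C in
/-- Values of elements of `A` lie in `O = m°`. [folklore] -/
theorem ev_mem_O_of_mem_A {z : K} (hz : z ∈ A) : ev φ z ∈ O := by
  rw [ev_eq_φ φ (Algebra.subset_adjoin hz)]; exact C.hφA ⟨z, hz⟩

include C in
/-- Values of constants from `k°` lie in `O`. [folklore] -/
theorem algebraMap_mem_O {c : k} (hc : c ∈ V) : algebraMap k m c ∈ O :=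
  algebraMap_mem_of_comap_eq' V O C.hOV hc

/-- `π ∈ O` (as an element of `m`). [folklore] -/
theorem π_mem_O : algebraMap k m C.π ∈ O := algebraMap_mem_O C C.hπV

/-- `π ≠ 0` in `m`. [folklore] -/
theorem π_ne_zero_m : algebraMap k m C.π ≠ 0 := (_root_.map_ne_zero _).mpr C.hπ0
/-! #### Uniform exponents over `Fin n` -/

/-- A uniform bound for finitely many exponents. [folklore] -/
theorem exists_uniform {P : Fin C.n → ℕ → Prop} (hmono : ∀ i N M, N ≤ M → P i N → P i M)
    (h : ∀ i, ∃ N, P i N) : ∃ N, ∀ i, P i N := by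
  classical
  choose N hN using h
  refine ⟨Finset.univ.sup N, fun i => hmono i (N i) _ (Finset.le_sup (Finset.mem_univ i)) (hN i)⟩

/-- Denominators in `Rh`: `hᴺ z ∈ R`, monotone in `N`. [folklore] -/
theorem pow_mul_mem_R_of_le {z : K} {N M : ℕ} (hNM : N ≤ M)
    (hz : C.h ^ N * z ∈ Algebra.adjoin k (A : Set K)) : C.h ^ M * z ∈ Algebra.adjoin k (A : Set K) := by
  have : C.h ^ M * z = C.h ^ (M - N) * (C.h ^ N * z) := by
    rw [← mul_assoc, ← pow_add, Nat.sub_add_cancel hNM]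
  rw [this]
  exact Subalgebra.mul_mem _ (Subalgebra.pow_mem _ C.hhR _) hz

/-- Denominators in `R`: `πᴺ r ∈ A₀`, monotone in `N`. [folklore] -/
theorem pow_mul_mem_A₀_of_le {z : K} {N M : ℕ} (hNM : N ≤ M) (hz : C.πK ^ N * z ∈ C.A₀) :
    C.πK ^ M * z ∈ C.A₀ := by
  have : C.πK ^ M * z = C.πK ^ (M - N) * (C.πK ^ N * z) := by
    rw [← mul_assoc, ← pow_add, Nat.sub_add_cancel hNM]
  rw [this]
  exact C.A₀.mul_mem (C.A₀.pow_mem C.πK_mem_A₀ _) hz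

/-- Joint denominators: every `z ∈ Rh` satisfies `πᵇ hᵃ z ∈ A₀` for some `a, b`. [folklore] -/
theorem exists_pow_mul_pow_mul_mem_A₀ {z : K} (hz : z ∈ C.Rh) :
    ∃ a b : ℕ, C.πK ^ b * (C.h ^ a * z) ∈ C.A₀ := by
  obtain ⟨a, ha⟩ := (C.mem_Rh_iff z).mp hz
  obtain ⟨b, hb⟩ := C.hden _ ha
  exact ⟨a, b, hb⟩

/-! #### The zoom functions `τᵢ = π^c h^L Tᵢ ∈ A₀` -/

/-- The `h`-exponent `L` with `h^L Tᵢ ∈ R` for all `i`. [folklore] -/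
theorem exists_L : ∃ L : ℕ, ∀ i, C.h ^ L * C.T i ∈ Algebra.adjoin k (A : Set K) :=
  C.exists_uniform (P := fun i N => C.h ^ N * C.T i ∈ Algebra.adjoin k (A : Set K))
    (fun _ _ _ hNM h => C.pow_mul_mem_R_of_le hNM h) (fun i => (C.mem_Rh_iff _).mp (C.hTRh i))

/-- The exponent `L`. [folklore] -/
def L : ℕ := C.exists_L.choose

/-- `h^L Tᵢ ∈ R`. [folklore] -/
theorem hL (i : Fin C.n) : C.h ^ C.L * C.T i ∈ Algebra.adjoin k (A : Set K) :=
  C.exists_L.choose_spec i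

/-- The `π`-exponent `c` with `π^c h^L Tᵢ ∈ A₀` for all `i`. [folklore] -/
theorem exists_c : ∃ c : ℕ, ∀ i, C.πK ^ c * (C.h ^ C.L * C.T i) ∈ C.A₀ :=
  C.exists_uniform (P := fun i N => C.πK ^ N * (C.h ^ C.L * C.T i) ∈ C.A₀)
    (fun _ _ _ hNM h => C.pow_mul_mem_A₀_of_le hNM h) (fun i => C.hden _ (C.hL i))

/-- The exponent `c`. [folklore] -/
def c : ℕ := C.exists_c.choose

/-- `π^c h^L Tᵢ ∈ A₀`. [folklore] -/
theorem hc (i : Fin C.n) : C.πK ^ C.c * (C.h ^ C.L * C.T i) ∈ C.A₀ := C.exists_c.choose_spec i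

/-- **The zoom functions** `τᵢ = π^c h^L Tᵢ` — elements of `A₀` vanishing at the point, generating
the maximal ideal of the point up to the units `π, h` of the generic fibre (Temkin's "system of
regular parameters `T`", multiplied "by a large power of `π`" into the model). [folklore] -/
def τ (i : Fin C.n) : K := C.πK ^ C.c * (C.h ^ C.L * C.T i)

/-- `τᵢ ∈ A₀`. [folklore] -/
theorem τ_mem_A₀ (i : Fin C.n) : C.τ i ∈ C.A₀ := C.hc i

/-- `τᵢ ∈ Rh`. [folklore] -/
theorem τ_mem_Rh (i : Fin C.n) : C.τ i ∈ C.Rh := C.A₀_subset_Rh (C.τ_mem_A₀ i)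

/-- `ev τᵢ = 0`. [folklore] -/
theorem ev_τ (i : Fin C.n) : ev φ (C.τ i) = 0 := by
  change ev φ (C.πK ^ C.c * (C.h ^ C.L * C.T i)) = 0
  rw [ev_mul φ ((Rx φ).pow_mem (C.A₀_subset_Rx C.πK_mem_A₀) _)
    ((Rx φ).mul_mem ((Rx φ).pow_mem (R_le_Rx φ C.hhR) _) (C.Rh_le_Rx (C.hTRh i))),
    ev_mul φ ((Rx φ).pow_mem (R_le_Rx φ C.hhR) _) (C.Rh_le_Rx (C.hTRh i)), C.ev_T, mul_zero, mul_zero]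

/-! #### `τ`-control -/

/-- `g ∈ K` is **`τ`-controlled with exponent `e`** if `π^e g = Σ τᵢ aᵢ` with `aᵢ ∈ A₀`: then `g`
becomes divisible by `π^{j-e}` in the `j`-th zoom ring, exactly. [folklore] -/
def TauControlled (g : K) (e : ℕ) : Prop :=
  ∃ a : Fin C.n → K, (∀ i, a i ∈ C.A₀) ∧ C.πK ^ e * g = ∑ i, C.τ i * a i

/-- The same with coefficients only in `R = k[A]` (an intermediate notion closed under
multiplication by `R`). [folklore] -/
def RTauControlled (g : K) (e : ℕ) : Prop :=
  ∃ b : Fin C.n → K, (∀ i, b i ∈ Algebra.adjoin k (A : Set K)) ∧ C.πK ^ e * g = ∑ i, C.τ i * b i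

variable {C} in
/-- `R`-coefficients can be scaled into `A₀`: `R`-`τ`-control implies `τ`-control with a larger
exponent. [folklore] -/
theorem RTauControlled.tauControlled {g : K} {e : ℕ} (hg : C.RTauControlled g e) :
    ∃ e', C.TauControlled g e' := by
  obtain ⟨b, hb, hbe⟩ := hg
  obtain ⟨e₁, he₁⟩ := C.exists_uniform (P := fun i N => C.πK ^ N * b i ∈ C.A₀)
    (fun _ _ _ hNM h => C.pow_mul_mem_A₀_of_le hNM h) (fun i => C.hden _ (hb i))
  refine ⟨e₁ + e, fun i => C.πK ^ e₁ * b i, he₁, ?_⟩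
  rw [pow_add, mul_assoc, hbe, Finset.mul_sum]
  refine Finset.sum_congr rfl fun i _ => ?_
  ring

variable {C} in
/-- `R`-`τ`-control is preserved under multiplication by elements of `R`. [folklore] -/
theorem RTauControlled.mul_left {g : K} {e : ℕ} (hg : C.RTauControlled g e) {r : K}
    (hr : r ∈ Algebra.adjoin k (A : Set K)) : C.RTauControlled (r * g) e := by
  obtain ⟨b, hb, hbe⟩ := hg
  refine ⟨fun i => r * b i, fun i => Subalgebra.mul_mem _ hr (hb i), ?_⟩
  rw [mul_left_comm, hbe, Finset.mul_sum]
  refine Finset.sum_congr rfl fun i _ => ?_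
  ring

variable {C} in
/-- `R`-`τ`-control (with a common exponent) is preserved under sums. [folklore] -/
theorem RTauControlled.add {g g' : K} {e : ℕ} (hg : C.RTauControlled g e)
    (hg' : C.RTauControlled g' e) : C.RTauControlled (g + g') e := by
  obtain ⟨b, hb, hbe⟩ := hg
  obtain ⟨b', hb', hbe'⟩ := hg'
  refine ⟨fun i => b i + b' i, fun i => Subalgebra.add_mem _ (hb i) (hb' i), ?_⟩
  rw [mul_add, hbe, hbe', ← Finset.sum_add_distrib]
  refine Finset.sum_congr rfl fun i _ => ?_
  ring

/-- **From linear control in `Rh` to `τ`-control**: if `z = Σ Tᵢ ρᵢ` with `ρᵢ ∈ Rh` then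
`h^{a+L} z` is `R`-`τ`-controlled with exponent `c` for all large `a` (clear the
`h`-denominators of the `ρᵢ`; the factor `π^c h^L` turns `Tᵢ` into `τᵢ`). [folklore] -/
theorem rtauControlled_of_eq_sum {z : K} {ρ : Fin C.n → K} (hρ : ∀ i, ρ i ∈ C.Rh)
    (hz : z = ∑ i, C.T i * ρ i) :
    ∃ a₀ : ℕ, ∀ a, a₀ ≤ a → C.RTauControlled (C.h ^ (a + C.L) * z) C.c := by
  obtain ⟨a₀, ha₀⟩ := C.exists_uniform
    (P := fun i N => C.h ^ N * ρ i ∈ Algebra.adjoin k (A : Set K))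
    (fun _ _ _ hNM h => C.pow_mul_mem_R_of_le hNM h) (fun i => (C.mem_Rh_iff _).mp (hρ i))
  refine ⟨a₀, fun a ha => ⟨fun i => C.h ^ a * ρ i, fun i => C.pow_mul_mem_R_of_le ha (ha₀ i), ?_⟩⟩
  rw [hz, Finset.mul_sum, Finset.mul_sum]
  refine Finset.sum_congr rfl fun i _ => ?_
  simp only [τ]
  ring

/-! #### The unit `s` of the zoom and the chart denominator `h` -/

/-- A control witness `s₀ ∈ Rh` with `φh(s₀) = 1` (from `exists_unit_linear_control`), as an
element of `K`. [folklore] -/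
def s₀ : K := (C.exists_unit_linear_control.choose : C.Rh)

/-- `s₀ ∈ Rh`. [folklore] -/
theorem s₀_mem_Rh : C.s₀ ∈ C.Rh := (C.exists_unit_linear_control.choose).2

/-- `ev s₀ = 1`. [folklore] -/
theorem ev_s₀ : ev φ C.s₀ = 1 := by
  rw [C.ev_of_mem C.s₀_mem_Rh]
  exact C.exists_unit_linear_control.choose_spec.1

/-- **Linear control through `s₀`**, in `K`: every `g ∈ Rh` vanishing at the point satisfies
`s₀ g = Σ Tᵢ ρᵢ` with `ρᵢ ∈ Rh`. [folklore] -/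
theorem exists_eq_sum_of_ev_eq_zero {g : K} (hg : g ∈ C.Rh) (hg0 : ev φ g = 0) :
    ∃ ρ : Fin C.n → K, (∀ i, ρ i ∈ C.Rh) ∧ C.s₀ * g = ∑ i, C.T i * ρ i := by
  have hctrl := C.exists_unit_linear_control.choose_spec.2 ⟨g, hg⟩
    (by rw [← C.ev_of_mem hg]; exact hg0)
  obtain ⟨ρ, hρ⟩ := Ideal.mem_span_range_iff_exists_fun.mp hctrl
  refine ⟨fun i => (ρ i : K), fun i => (ρ i).2, ?_⟩
  have h1 : ((C.exists_unit_linear_control.choose * ⟨g, hg⟩ : C.Rh) : K) =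
      ((∑ i, ρ i * C.Tsub i : C.Rh) : K) := by rw [hρ]
  have h2 : ((∑ i, ρ i * C.Tsub i : C.Rh) : K) = ∑ i, ((ρ i * C.Tsub i : C.Rh) : K) :=
    map_sum C.Rh.val _ _
  rw [h2] at h1
  change ((C.exists_unit_linear_control.choose * ⟨g, hg⟩ : C.Rh) : K) = _
  rw [h1]
  refine Finset.sum_congr rfl fun i _ => ?_
  rw [Subalgebra.coe_mul, coe_Tsub, mul_comm]

/-- `s₀ (s₀ - 1)` is controlled. [folklore] -/
theorem exists_eq_sum_s₀ :
    ∃ ρ : Fin C.n → K, (∀ i, ρ i ∈ C.Rh) ∧ C.s₀ * (C.s₀ - 1) = ∑ i, C.T i * ρ i :=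
  C.exists_eq_sum_of_ev_eq_zero (C.Rh.sub_mem C.s₀_mem_Rh C.Rh.one_mem)
    (by rw [ev_sub φ (C.Rh_le_Rx C.s₀_mem_Rh) (Rx φ).one_mem, C.ev_s₀, ev_one φ, sub_self])

/-- `s₀ (h - 1)` is controlled. [folklore] -/
theorem exists_eq_sum_h :
    ∃ ρ : Fin C.n → K, (∀ i, ρ i ∈ C.Rh) ∧ C.s₀ * (C.h - 1) = ∑ i, C.T i * ρ i :=
  C.exists_eq_sum_of_ev_eq_zero (C.Rh.sub_mem (C.R_le_Rh C.hhR) C.Rh.one_mem)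
    (by rw [ev_sub φ (R_le_Rx φ C.hhR) (Rx φ).one_mem, C.ev_h, ev_one φ, sub_self])

/-- The `h`-exponent of the unit `s = h^α s₀`: large enough to clear the `h`-denominators of
`s₀` and of the control coefficients of `s₀(s₀ - 1)` and `s₀(h - 1)`, plus `L`. [folklore] -/
theorem exists_α : ∃ α : ℕ, C.h ^ α * C.s₀ ∈ Algebra.adjoin k (A : Set K) ∧
    C.RTauControlled (C.h ^ α * (C.s₀ * (C.s₀ - 1))) C.c ∧
    C.RTauControlled (C.h ^ α * (C.s₀ * (C.h - 1))) C.c := by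
  obtain ⟨d, hd⟩ := (C.mem_Rh_iff _).mp C.s₀_mem_Rh
  obtain ⟨ρ₀, hρ₀, h₀⟩ := C.exists_eq_sum_s₀
  obtain ⟨a₀, ha₀⟩ := C.rtauControlled_of_eq_sum hρ₀ h₀
  obtain ⟨ρ₁, hρ₁, h₁⟩ := C.exists_eq_sum_h
  obtain ⟨a₁, ha₁⟩ := C.rtauControlled_of_eq_sum hρ₁ h₁
  refine ⟨max d (max a₀ a₁) + C.L, C.pow_mul_mem_R_of_le (by omega) hd,
    ha₀ _ (by omega), ha₁ _ (by omega)⟩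

/-- The exponent `α`. [folklore] -/
def α : ℕ := C.exists_α.choose

/-- **The unit of the zoom** `s = h^α s₀ ∈ R`: `φ(s) = 1`, and both `s(s - 1)` and `s(h - 1)`
are `τ`-controlled — so that, in the zoom rings, `s` is integral (an approximate idempotent
separating the centre of `m°` from the rest of the special fibre) and `h` becomes a unit near
the centre. [folklore] -/
def s : K := C.h ^ C.α * C.s₀

/-- `s ∈ R`. [folklore] -/
theorem s_mem_R : C.s ∈ Algebra.adjoin k (A : Set K) := C.exists_α.choose_spec.1

/-- `s ∈ Rh`. [folklore] -/
theorem s_mem_Rh : C.s ∈ C.Rh := C.R_le_Rh C.s_mem_R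

/-- `ev s = 1`. [folklore] -/
theorem ev_s : ev φ C.s = 1 := by
  change ev φ (C.h ^ C.α * C.s₀) = 1
  rw [ev_mul φ ((Rx φ).pow_mem (R_le_Rx φ C.hhR) _) (C.Rh_le_Rx C.s₀_mem_Rh),
    ev_pow φ (R_le_Rx φ C.hhR), C.ev_h, one_pow, C.ev_s₀, mul_one]

/-- `s (h - 1)` is `τ`-controlled. [folklore] -/
theorem tauControlled_s_mul_h_sub_one : ∃ e, C.TauControlled (C.s * (C.h - 1)) e := by
  have := C.exists_α.choose_spec.2.2
  rw [← mul_assoc] at this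
  exact this.tauControlled

/-- `s (s - 1)` is `τ`-controlled: `s(s-1) = h^α·(h^α s₀(s₀-1)) + (Σ_{l<α} h^l)·(h^α s₀(h-1))`.
[folklore] -/
theorem tauControlled_s_mul_s_sub_one : ∃ e, C.TauControlled (C.s * (C.s - 1)) e := by
  obtain ⟨-, h₀, h₁⟩ := C.exists_α.choose_spec
  have hgeom : C.h ^ C.α - 1 = (C.h - 1) * ∑ l ∈ Finset.range C.α, C.h ^ l :=
    (mul_geom_sum C.h C.α).symm.trans (by ring)
  have key : C.s * (C.s - 1) = C.h ^ C.α * (C.h ^ C.α * (C.s₀ * (C.s₀ - 1))) +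
      (∑ l ∈ Finset.range C.α, C.h ^ l) * (C.h ^ C.α * (C.s₀ * (C.h - 1))) := by
    have : C.s * (C.s - 1) = C.h ^ C.α * (C.h ^ C.α * (C.s₀ * (C.s₀ - 1))) +
        C.h ^ C.α * C.s₀ * (C.h ^ C.α - 1) := by simp only [s]; ring
    rw [this, hgeom]; ring
  rw [key]
  have hsum : C.RTauControlled (C.h ^ C.α * (C.h ^ C.α * (C.s₀ * (C.s₀ - 1))) +
      (∑ l ∈ Finset.range C.α, C.h ^ l) * (C.h ^ C.α * (C.s₀ * (C.h - 1)))) C.c :=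
    RTauControlled.add (h₀.mul_left (Subalgebra.pow_mem _ C.hhR _))
      (h₁.mul_left (Subalgebra.sum_mem _ fun l _ => Subalgebra.pow_mem _ C.hhR _))
  exact hsum.tauControlled

/-- **Linear control, `τ`-form**: for `g ∈ Rh` vanishing at the point, `h^{a+L} s₀ g` is
`τ`-controlled for all large `a`. [folklore] -/
theorem tauControlled_of_ev_eq_zero {g : K} (hg : g ∈ C.Rh) (hg0 : ev φ g = 0) :
    ∃ a₀ : ℕ, ∀ a, a₀ ≤ a → ∃ e, C.TauControlled (C.h ^ (a + C.L) * (C.s₀ * g)) e := by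
  obtain ⟨ρ, hρ, hsum⟩ := C.exists_eq_sum_of_ev_eq_zero hg hg0
  obtain ⟨a₀, ha₀⟩ := C.rtauControlled_of_eq_sum hρ hsum
  exact ⟨a₀, fun a ha => (ha₀ a ha).tauControlled⟩

end DecompChart

end Literature.AlgebraicGeometry.Resolution
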